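import Literature.Computability.Complexity.StackModArith
import HarnessLib

/-!
# Signed integers for structured stack programs, I: difference pairs, addition, normal form

Trunk `CplxCore`, toolkit continuing `StackArith.lean` (the arithmetic bank `AReg` with `add`,
`sub`, `normalize`). Inside a computation a signed integer is held **sign-free** as a
*difference pair* of numerals `(P, Q)`, value `⟦P⟧ - ⟦Q⟧` (`pairVal`), so that addition,
subtraction and (in part II) multiplication are straight-line sequences of natural-number
operations without case analysis on signs; the canonical form `(|z|, 0)` / `(0, |z|)`
(`pnorm`, one comparison) is taken before divisions, sign tests and storage. Register file
`ZOwn ⊕ AReg`, where `ZOwn = {P₁, Q₁, P₂, Q₂, R₁, R₂, M, W}` holds two difference pairs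
`(P₁, Q₁)`, `(P₂, Q₂)` (the only own registers used in this file) and four registers `R₁, R₂`
(an accumulator pair), `M` (multiplier/dividend) and `W` (spare) reserved for part II
(`StackIntsMul.lean`); the bank, kept clean between operations, does the arithmetic, bank
programs being embedded by `Com.bk = Com.map Sum.inr` of `StackModArith.lean`:

* `Com.natAddTo a b` — over any `κ ⊕ AReg`: `a := ⟦a⟧ + ⟦b⟧` (canonical numeral), `b := []`,
  for two distinct outer registers `a b : κ` (`runs_natAddTo`);
* `Com.padd`, `Com.psub` — `(P₁,Q₁) := (P₁,Q₁) ± (P₂,Q₂)`, consuming the second pair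
  (`runs_padd`, `runs_psub`; values `pairVal_padd`, `pairVal_psub`);
* `Com.pnorm` — canonical form of `(P₁, Q₁)` (`runs_pnorm`).

All numerals produced are canonical (`encodeNat`), so register lengths are the binary sizes of
the values, which is what the polynomial bounds of the LLL machine are stated in.

## References

* D. E. Knuth, *The Art of Computer Programming*, Vol. 2, 3rd ed., Addison-Wesley 1998, §4.3.1
  (multiple-precision addition/subtraction; signed magnitudes via comparison). (Not held.)
* T. Nipkow, G. Klein, *Concrete Semantics with Isabelle/HOL*, Springer 2014, Ch. 7.
-/

namespace Literature.Computability.Complexity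

open _root_.Computability AReg

namespace Com

/-! ### The register file -/

/-- Own registers of the signed-integer routines: two difference pairs `(P₁,Q₁)`, `(P₂,Q₂)`,
two accumulators `R₁ R₂`, the multiplier/dividend register `M` (most significant bit first) and a
spare `W`. [folklore] -/
inductive ZOwn where
  | P₁ | Q₁ | P₂ | Q₂ | R₁ | R₂ | M | W
  deriving DecidableEq, Fintype, Repr

namespace ZOwn

/-- A file of the own registers given register by register. [folklore] -/
def file (p₁ q₁ p₂ q₂ r₁ r₂ mm ww : List Bool) : Regs ZOwn
  | .P₁ => p₁ | .Q₁ => q₁ | .P₂ => p₂ | .Q₂ => q₂ | .R₁ => r₁ | .R₂ => r₂ | .M => mm | .W => ww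

section
variable (p₁ q₁ p₂ q₂ r₁ r₂ mm ww v : List Bool)

/-- Reading `P₁`. [folklore] -/ @[simp] theorem file_P₁ : file p₁ q₁ p₂ q₂ r₁ r₂ mm ww .P₁ = p₁ := rfl

/-- Reading `Q₁`. [folklore] -/ @[simp] theorem file_Q₁ : file p₁ q₁ p₂ q₂ r₁ r₂ mm ww .Q₁ = q₁ := rfl

/-- Reading `P₂`. [folklore] -/ @[simp] theorem file_P₂ : file p₁ q₁ p₂ q₂ r₁ r₂ mm ww .P₂ = p₂ := rfl

/-- Reading `Q₂`. [folklore] -/ @[simp] theorem file_Q₂ : file p₁ q₁ p₂ q₂ r₁ r₂ mm ww .Q₂ = q₂ := rfl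

/-- Reading `R₁`. [folklore] -/ @[simp] theorem file_R₁ : file p₁ q₁ p₂ q₂ r₁ r₂ mm ww .R₁ = r₁ := rfl

/-- Reading `R₂`. [folklore] -/ @[simp] theorem file_R₂ : file p₁ q₁ p₂ q₂ r₁ r₂ mm ww .R₂ = r₂ := rfl

/-- Reading `M`. [folklore] -/ @[simp] theorem file_M : file p₁ q₁ p₂ q₂ r₁ r₂ mm ww .M = mm := rfl

/-- Reading `W`. [folklore] -/ @[simp] theorem file_W : file p₁ q₁ p₂ q₂ r₁ r₂ mm ww .W = ww := rfl

/-- Writing `P₁`. [folklore] -/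
@[simp] theorem update_file_P₁ : Function.update (file p₁ q₁ p₂ q₂ r₁ r₂ mm ww) .P₁ v = file v q₁ p₂ q₂ r₁ r₂ mm ww := by
  funext r; cases r <;> rfl

/-- Writing `Q₁`. [folklore] -/
@[simp] theorem update_file_Q₁ : Function.update (file p₁ q₁ p₂ q₂ r₁ r₂ mm ww) .Q₁ v = file p₁ v p₂ q₂ r₁ r₂ mm ww := by
  funext r; cases r <;> rfl

/-- Writing `P₂`. [folklore] -/
@[simp] theorem update_file_P₂ : Function.update (file p₁ q₁ p₂ q₂ r₁ r₂ mm ww) .P₂ v = file p₁ q₁ v q₂ r₁ r₂ mm ww := by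
  funext r; cases r <;> rfl

/-- Writing `Q₂`. [folklore] -/
@[simp] theorem update_file_Q₂ : Function.update (file p₁ q₁ p₂ q₂ r₁ r₂ mm ww) .Q₂ v = file p₁ q₁ p₂ v r₁ r₂ mm ww := by
  funext r; cases r <;> rfl

/-- Writing `R₁`. [folklore] -/
@[simp] theorem update_file_R₁ : Function.update (file p₁ q₁ p₂ q₂ r₁ r₂ mm ww) .R₁ v = file p₁ q₁ p₂ q₂ v r₂ mm ww := by
  funext r; cases r <;> rfl

/-- Writing `R₂`. [folklore] -/
@[simp] theorem update_file_R₂ : Function.update (file p₁ q₁ p₂ q₂ r₁ r₂ mm ww) .R₂ v = file p₁ q₁ p₂ q₂ r₁ v mm ww := by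
  funext r; cases r <;> rfl

/-- Writing `M`. [folklore] -/
@[simp] theorem update_file_M : Function.update (file p₁ q₁ p₂ q₂ r₁ r₂ mm ww) .M v = file p₁ q₁ p₂ q₂ r₁ r₂ v ww := by
  funext r; cases r <;> rfl

/-- Writing `W`. [folklore] -/
@[simp] theorem update_file_W : Function.update (file p₁ q₁ p₂ q₂ r₁ r₂ mm ww) .W v = file p₁ q₁ p₂ q₂ r₁ r₂ mm v := by
  funext r; cases r <;> rfl

end

/-- Every register file is a `file`. [folklore] -/
theorem eq_file (R : Regs ZOwn) : R = file (R .P₁) (R .Q₁) (R .P₂) (R .Q₂) (R .R₁) (R .R₂) (R .M) (R .W) := by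
  funext r; cases r <;> rfl

end ZOwn

/-- The register file of the signed-integer routines. [folklore] -/
abbrev ZReg := ZOwn ⊕ AReg

/-- The value of a difference pair. [folklore] -/
def pairVal (p q : List Bool) : ℤ := (bitsToNat p : ℤ) - bitsToNat q

/-! ### Natural addition between two outer registers -/

section Embedded

variable {κ : Type} [DecidableEq κ]

/-- `natAddTo a b` (outer registers `a ≠ b` of any `κ ⊕ AReg`): `a := ⟦a⟧ + ⟦b⟧` as a canonical
numeral, `b := []`, through the bank, whose registers `x`, `y`, `s`, `t`, `f` must be empty
(`z`, `u`, `g` are untouched). [Knuth 1998, §4.3.1, Algorithm A] [folklore] -/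
def natAddTo (a b : κ) : Com (κ ⊕ AReg) :=
  move (.inl a) (.inr .x) (.inr .t) ;; move (.inl b) (.inr .y) (.inr .t) ;;
  bk add ;; bk normalize ;; move (.inr .x) (.inl a) (.inr .t) ;; clear (.inr .y)

/-- **Simulation of `natAddTo`** (`a ≠ b`; bank registers `x y s t f` empty): `a := ⟦a⟧ + ⟦b⟧`
canonical, `b := []`, within `40(|a| + |b|) + 40` steps. [Knuth 1998, §4.3.1, Algorithm A] [folklore] -/
theorem runs_natAddTo {a b : κ} (hab : a ≠ b) (Z : Regs κ) (z u g : List Bool) :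
    Runs (natAddTo a b) (Sum.elim Z (AReg.file [] [] z [] [] u [] g))
      (Sum.elim (Function.update (Function.update Z a (encodeNat (bitsToNat (Z a) + bitsToNat (Z b)))) b [])
        (AReg.file [] [] z [] [] u [] g))
      (40 * ((Z a).length + (Z b).length) + 40) := by
  set pa := Z a with hpa
  set pb := Z b with hpb
  -- move the operands in
  have h1 := runs_move (ι := κ ⊕ AReg) (a := .inl a) (b := .inr .x) (t := .inr .t) (by simp) (by simp) (by simp)
    (Sum.elim Z (AReg.file [] [] z [] [] u [] g)) rfl
  simp only [Sum.elim_inl, Sum.elim_inr, file_x, Sum.update_elim_inl, Sum.update_elim_inr, update_file_x,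
    List.append_nil] at h1
  rw [← hpa] at h1
  have h2 := runs_move (ι := κ ⊕ AReg) (a := .inl b) (b := .inr .y) (t := .inr .t) (by simp) (by simp) (by simp)
    (Sum.elim (Function.update Z a []) (AReg.file pa [] z [] [] u [] g)) rfl
  simp only [Sum.elim_inl, Sum.elim_inr, file_y, Sum.update_elim_inl, Sum.update_elim_inr, update_file_y,
    List.append_nil, Function.update_of_ne (Ne.symm hab)] at h2
  rw [← hpb] at h2
  set Z₂ := Function.update (Function.update Z a []) b [] with hZ₂
  -- add and normalise in the bank
  have h3 : Runs (bk add) (Sum.elim Z₂ (AReg.file pa pb z [] [] u [] g))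
      (Sum.elim Z₂ (AReg.file (addRes pa pb) pb z [] [] u [] g)) (13 * (pa.length + pb.length) + 12) :=
    (runs_add pa pb z u g).inr _
  have h4 : Runs (bk normalize) (Sum.elim Z₂ (AReg.file (addRes pa pb) pb z [] [] u [] g))
      (Sum.elim Z₂ (AReg.file (norm (addRes pa pb)) pb z [] [] u [] g)) (9 * (addRes pa pb).length + 5) :=
    (runs_normalize (addRes pa pb) pb z [] u g).inr _
  -- move the result out, clear `y`
  have h5 := runs_move (ι := κ ⊕ AReg) (a := .inr .x) (b := .inl a) (t := .inr .t) (by simp) (by simp) (by simp)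
    (Sum.elim Z₂ (AReg.file (norm (addRes pa pb)) pb z [] [] u [] g)) rfl
  simp only [Sum.elim_inl, Sum.elim_inr, file_x, Sum.update_elim_inl, Sum.update_elim_inr, update_file_x] at h5
  have hZ₂a : Z₂ a = [] := by
    rw [hZ₂]; by_cases h : a = b
    · exact absurd h hab
    · rw [Function.update_of_ne h, Function.update_self]
  rw [hZ₂a, List.append_nil] at h5
  have h6 := runs_clear (ι := κ ⊕ AReg) (.inr .y)
    (Sum.elim (Function.update Z₂ a (norm (addRes pa pb))) (AReg.file [] pb z [] [] u [] g))
  simp only [Sum.elim_inr, file_y, Sum.update_elim_inr, update_file_y] at h6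
  have hlen := length_addRes_le pa pb
  have hnorm := length_norm_le (addRes pa pb)
  refine (h1.seq (h2.seq (h3.seq (h4.seq (h5.seq h6))))).of_eq ?_ ?_
  · rw [norm_eq_encodeNat, bitsToNat_addRes, hZ₂, Function.update_comm hab (f := Z), Function.update_idem,
      Function.update_comm (Ne.symm hab)]
  · omega

end Embedded

/-! ### Addition and subtraction of difference pairs -/

/-- `padd`: `(P₁, Q₁) := (P₁ + P₂, Q₁ + Q₂)`, consuming the second pair. [folklore] -/
def padd : Com ZReg := natAddTo .P₁ .P₂ ;; natAddTo .Q₁ .Q₂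

/-- `psub`: `(P₁, Q₁) := (P₁ + Q₂, Q₁ + P₂)`, consuming the second pair. [folklore] -/
def psub : Com ZReg := natAddTo .P₁ .Q₂ ;; natAddTo .Q₁ .P₂

/-- **Simulation of `padd`.** [folklore] -/
theorem runs_padd (p₁ q₁ p₂ q₂ r₁ r₂ mm ww z u g : List Bool) :
    Runs padd (Sum.elim (ZOwn.file p₁ q₁ p₂ q₂ r₁ r₂ mm ww) (AReg.file [] [] z [] [] u [] g))
      (Sum.elim (ZOwn.file (encodeNat (bitsToNat p₁ + bitsToNat p₂)) (encodeNat (bitsToNat q₁ + bitsToNat q₂)) [] [] r₁ r₂ mm ww)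
        (AReg.file [] [] z [] [] u [] g))
      (40 * (p₁.length + p₂.length + q₁.length + q₂.length) + 80) := by
  have h1 := runs_natAddTo (a := .P₁) (b := .P₂) (by decide) (ZOwn.file p₁ q₁ p₂ q₂ r₁ r₂ mm ww) z u g
  simp only [ZOwn.file_P₁, ZOwn.file_P₂, ZOwn.update_file_P₁, ZOwn.update_file_P₂] at h1
  have h2 := runs_natAddTo (a := .Q₁) (b := .Q₂) (by decide)
    (ZOwn.file (encodeNat (bitsToNat p₁ + bitsToNat p₂)) q₁ [] q₂ r₁ r₂ mm ww) z u g
  simp only [ZOwn.file_Q₁, ZOwn.file_Q₂, ZOwn.update_file_Q₁, ZOwn.update_file_Q₂] at h2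
  exact (h1.seq h2).of_eq rfl (by omega)

/-- **Simulation of `psub`.** [folklore] -/
theorem runs_psub (p₁ q₁ p₂ q₂ r₁ r₂ mm ww z u g : List Bool) :
    Runs psub (Sum.elim (ZOwn.file p₁ q₁ p₂ q₂ r₁ r₂ mm ww) (AReg.file [] [] z [] [] u [] g))
      (Sum.elim (ZOwn.file (encodeNat (bitsToNat p₁ + bitsToNat q₂)) (encodeNat (bitsToNat q₁ + bitsToNat p₂)) [] [] r₁ r₂ mm ww)
        (AReg.file [] [] z [] [] u [] g))
      (40 * (p₁.length + p₂.length + q₁.length + q₂.length) + 80) := by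
  have h1 := runs_natAddTo (a := .P₁) (b := .Q₂) (by decide) (ZOwn.file p₁ q₁ p₂ q₂ r₁ r₂ mm ww) z u g
  simp only [ZOwn.file_P₁, ZOwn.file_Q₂, ZOwn.update_file_P₁, ZOwn.update_file_Q₂] at h1
  have h2 := runs_natAddTo (a := .Q₁) (b := .P₂) (by decide)
    (ZOwn.file (encodeNat (bitsToNat p₁ + bitsToNat q₂)) q₁ p₂ [] r₁ r₂ mm ww) z u g
  simp only [ZOwn.file_Q₁, ZOwn.file_P₂, ZOwn.update_file_Q₁, ZOwn.update_file_P₂] at h2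
  exact (h1.seq h2).of_eq rfl (by omega)

/-- The value computed by `padd` is the sum. [folklore] -/
theorem pairVal_padd (p₁ q₁ p₂ q₂ : List Bool) :
    pairVal (encodeNat (bitsToNat p₁ + bitsToNat p₂)) (encodeNat (bitsToNat q₁ + bitsToNat q₂)) =
      pairVal p₁ q₁ + pairVal p₂ q₂ := by
  simp only [pairVal, bitsToNat_encodeNat]; push_cast; ring

/-- The value computed by `psub` is the difference. [folklore] -/
theorem pairVal_psub (p₁ q₁ p₂ q₂ : List Bool) :
    pairVal (encodeNat (bitsToNat p₁ + bitsToNat q₂)) (encodeNat (bitsToNat q₁ + bitsToNat p₂)) =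
      pairVal p₁ q₁ - pairVal p₂ q₂ := by
  simp only [pairVal, bitsToNat_encodeNat]; push_cast; ring

/-! ### Canonical form -/

/-- First component of the canonical form of a difference pair `(p, q)`, value `z = ⟦p⟧ - ⟦q⟧`:
the canonical form is `(|z|, 0)` if `z ≥ 0` and `(0, |z|)` otherwise (canonical numerals), so
this is `encodeNat (⟦p⟧ - ⟦q⟧)` if `⟦q⟧ ≤ ⟦p⟧` and `[]` otherwise. [folklore] -/
def pnormP (p q : List Bool) : List Bool :=
  if bitsToNat q ≤ bitsToNat p then encodeNat (bitsToNat p - bitsToNat q) else []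

/-- Second component of the canonical form: `[]` if `⟦q⟧ ≤ ⟦p⟧`, else `encodeNat (⟦q⟧ - ⟦p⟧)`.
[folklore] -/
def pnormQ (p q : List Bool) : List Bool :=
  if bitsToNat q ≤ bitsToNat p then [] else encodeNat (bitsToNat q - bitsToNat p)

/-- The canonical form has the same value. [folklore] -/
theorem pairVal_pnorm (p q : List Bool) : pairVal (pnormP p q) (pnormQ p q) = pairVal p q := by
  unfold pnormP pnormQ pairVal
  split_ifs with h
  · simp [bitsToNat_encodeNat]; omega
  · simp [bitsToNat_encodeNat]; omega

/-- `pnorm`: canonical form of `(P₁, Q₁)` by one comparison-subtraction in the bank (and a second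
subtraction after exchanging the operands when `P₁ < Q₁`). [Knuth 1998, §4.3.1, Algorithm S]
[folklore] -/
def pnorm : Com ZReg :=
  move (.inl .P₁) (.inr .x) (.inr .t) ;; move (.inl .Q₁) (.inr .y) (.inr .t) ;; bk sub ;;
  pop (.inr .g)
    (bk normalize ;; move (.inr .x) (.inl .P₁) (.inr .t) ;; clear (.inr .y))
    (bk normalize ;; move (.inr .x) (.inl .P₁) (.inr .t) ;; clear (.inr .y))
    (pour (.inr .x) (.inr .s) ;; pour (.inr .y) (.inr .t) ;; pour (.inr .s) (.inr .y) ;; pour (.inr .t) (.inr .x) ;;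
      bk sub ;; clear (.inr .g) ;; bk normalize ;; move (.inr .x) (.inl .Q₁) (.inr .t) ;; clear (.inr .y))

/-- **Simulation of `pnorm`** (bank clean): `(P₁, Q₁) := (pnormP, pnormQ)`, within
`70(|P₁| + |Q₁|) + 60` steps. [Knuth 1998, §4.3.1, Algorithm S] [folklore] -/
theorem runs_pnorm (p q p₂ q₂ r₁ r₂ mm ww z : List Bool) :
    Runs pnorm (Sum.elim (ZOwn.file p q p₂ q₂ r₁ r₂ mm ww) (AReg.file [] [] z [] [] [] [] []))
      (Sum.elim (ZOwn.file (pnormP p q) (pnormQ p q) p₂ q₂ r₁ r₂ mm ww) (AReg.file [] [] z [] [] [] [] []))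
      (70 * (p.length + q.length) + 60) := by
  -- move the operands in and compare
  have h1 := runs_move (ι := ZReg) (a := .inl .P₁) (b := .inr .x) (t := .inr .t) (by simp) (by simp) (by decide)
    (Sum.elim (ZOwn.file p q p₂ q₂ r₁ r₂ mm ww) (AReg.file [] [] z [] [] [] [] [])) rfl
  simp only [Sum.elim_inl, Sum.elim_inr, file_x, Sum.update_elim_inl, Sum.update_elim_inr, update_file_x,
    ZOwn.file_P₁, ZOwn.update_file_P₁, List.append_nil] at h1
  have h2 := runs_move (ι := ZReg) (a := .inl .Q₁) (b := .inr .y) (t := .inr .t) (by simp) (by simp) (by decide)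
    (Sum.elim (ZOwn.file [] q p₂ q₂ r₁ r₂ mm ww) (AReg.file p [] z [] [] [] [] [])) rfl
  simp only [Sum.elim_inl, Sum.elim_inr, file_y, Sum.update_elim_inl, Sum.update_elim_inr, update_file_y,
    ZOwn.file_Q₁, ZOwn.update_file_Q₁, List.append_nil] at h2
  have h3 : Runs (bk sub) (Sum.elim (ZOwn.file [] [] p₂ q₂ r₁ r₂ mm ww) (AReg.file p q z [] [] [] [] []))
      (Sum.elim (ZOwn.file [] [] p₂ q₂ r₁ r₂ mm ww) (AReg.file (bif subBorrow p q then p else subRes p q) q z [] [] [] []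
        (flag !subBorrow p q))) (16 * (p.length + q.length) + 12) := (runs_sub p q z).inr _
  by_cases hle : bitsToNat q ≤ bitsToNat p
  · -- no borrow: `x = p - q`
    have hb : subBorrow p q = false := by rw [subBorrow_iff]; simpa using hle
    rw [hb] at h3
    simp only [Bool.not_false, cond_false, flag_true] at h3
    have h4 : Runs (bk normalize) (Sum.elim (ZOwn.file [] [] p₂ q₂ r₁ r₂ mm ww) (AReg.file (subRes p q) q z [] [] [] [] []))
        (Sum.elim (ZOwn.file [] [] p₂ q₂ r₁ r₂ mm ww) (AReg.file (norm (subRes p q)) q z [] [] [] [] [])) (9 * (subRes p q).length + 5) :=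
      (runs_normalize (subRes p q) q z [] [] []).inr _
    have h5 := runs_move (ι := ZReg) (a := .inr .x) (b := .inl .P₁) (t := .inr .t) (by simp) (by decide) (by simp)
      (Sum.elim (ZOwn.file [] [] p₂ q₂ r₁ r₂ mm ww) (AReg.file (norm (subRes p q)) q z [] [] [] [] [])) rfl
    simp only [Sum.elim_inl, Sum.elim_inr, file_x, Sum.update_elim_inl, Sum.update_elim_inr, update_file_x,
      ZOwn.file_P₁, ZOwn.update_file_P₁, List.append_nil] at h5
    have h6 := runs_clear (ι := ZReg) (.inr .y)
      (Sum.elim (ZOwn.file (norm (subRes p q)) [] p₂ q₂ r₁ r₂ mm ww) (AReg.file [] q z [] [] [] [] []))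
    simp only [Sum.elim_inr, file_y, Sum.update_elim_inr, update_file_y] at h6
    have hbr := Runs.pop_true' (k := (Sum.inr AReg.g : ZReg))
      (bk normalize ;; move (.inr .x) (.inl .P₁) (.inr .t) ;; clear (.inr .y))
      (pour (.inr .x) (.inr .s) ;; pour (.inr .y) (.inr .t) ;; pour (.inr .s) (.inr .y) ;; pour (.inr .t) (.inr .x) ;;
        bk sub ;; clear (.inr .g) ;; bk normalize ;; move (.inr .x) (.inl .Q₁) (.inr .t) ;; clear (.inr .y))
      (R := Sum.elim (ZOwn.file [] [] p₂ q₂ r₁ r₂ mm ww) (AReg.file (subRes p q) q z [] [] [] [] [true]))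
      (R₀ := Sum.elim (ZOwn.file [] [] p₂ q₂ r₁ r₂ mm ww) (AReg.file (subRes p q) q z [] [] [] [] [])) (w := []) rfl
      (by simp only [Sum.update_elim_inr, update_file_g]) (h4.seq (h5.seq h6))
    have hlen : (subRes p q).length = p.length := length_subRes p q
    have hnorm := length_norm_le (subRes p q)
    refine (h1.seq (h2.seq (h3.seq hbr))).of_eq ?_ ?_
    · simp only [pnormP, pnormQ, if_pos hle, norm_eq_encodeNat, bitsToNat_subRes p q hle]
    · omega
  · -- borrow: exchange and subtract again
    have hlt : bitsToNat p < bitsToNat q := not_le.1 hle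
    have hb : subBorrow p q = true := by rw [subBorrow_iff]; simpa using hlt
    rw [hb] at h3
    simp only [Bool.not_true, cond_true, flag_false] at h3
    -- the four pours exchanging `x` and `y`
    have e1 := runs_pour (ι := ZReg) (a := .inr .x) (b := .inr .s) (by decide)
      (Sum.elim (ZOwn.file [] [] p₂ q₂ r₁ r₂ mm ww) (AReg.file p q z [] [] [] [] []))
    simp only [Sum.elim_inr, file_x, file_s, Sum.update_elim_inr, update_file_x, update_file_s, List.append_nil] at e1
    have e2 := runs_pour (ι := ZReg) (a := .inr .y) (b := .inr .t) (by decide)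
      (Sum.elim (ZOwn.file [] [] p₂ q₂ r₁ r₂ mm ww) (AReg.file [] q z p.reverse [] [] [] []))
    simp only [Sum.elim_inr, file_y, file_t, Sum.update_elim_inr, update_file_y, update_file_t, List.append_nil] at e2
    have e3 := runs_pour (ι := ZReg) (a := .inr .s) (b := .inr .y) (by decide)
      (Sum.elim (ZOwn.file [] [] p₂ q₂ r₁ r₂ mm ww) (AReg.file [] [] z p.reverse q.reverse [] [] []))
    simp only [Sum.elim_inr, file_s, file_y, Sum.update_elim_inr, update_file_s, update_file_y, List.append_nil,
      List.reverse_reverse] at e3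
    have e4 := runs_pour (ι := ZReg) (a := .inr .t) (b := .inr .x) (by decide)
      (Sum.elim (ZOwn.file [] [] p₂ q₂ r₁ r₂ mm ww) (AReg.file [] p z [] q.reverse [] [] []))
    simp only [Sum.elim_inr, file_t, file_x, Sum.update_elim_inr, update_file_t, update_file_x, List.append_nil,
      List.reverse_reverse] at e4
    have h4 : Runs (bk sub) (Sum.elim (ZOwn.file [] [] p₂ q₂ r₁ r₂ mm ww) (AReg.file q p z [] [] [] [] []))
        (Sum.elim (ZOwn.file [] [] p₂ q₂ r₁ r₂ mm ww) (AReg.file (subRes q p) p z [] [] [] [] [true]))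
        (16 * (q.length + p.length) + 12) := by
      have := (runs_sub q p z).inr (ZOwn.file [] [] p₂ q₂ r₁ r₂ mm ww)
      have hb' : subBorrow q p = false := by rw [subBorrow_iff]; simpa using hlt.le
      rw [hb'] at this
      simpa using this
    have h5 := runs_clear (ι := ZReg) (.inr .g)
      (Sum.elim (ZOwn.file [] [] p₂ q₂ r₁ r₂ mm ww) (AReg.file (subRes q p) p z [] [] [] [] [true]))
    simp only [Sum.elim_inr, file_g, Sum.update_elim_inr, update_file_g] at h5
    have h6 : Runs (bk normalize) (Sum.elim (ZOwn.file [] [] p₂ q₂ r₁ r₂ mm ww) (AReg.file (subRes q p) p z [] [] [] [] []))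
        (Sum.elim (ZOwn.file [] [] p₂ q₂ r₁ r₂ mm ww) (AReg.file (norm (subRes q p)) p z [] [] [] [] [])) (9 * (subRes q p).length + 5) :=
      (runs_normalize (subRes q p) p z [] [] []).inr _
    have h7 := runs_move (ι := ZReg) (a := .inr .x) (b := .inl .Q₁) (t := .inr .t) (by simp) (by decide) (by simp)
      (Sum.elim (ZOwn.file [] [] p₂ q₂ r₁ r₂ mm ww) (AReg.file (norm (subRes q p)) p z [] [] [] [] [])) rfl
    simp only [Sum.elim_inl, Sum.elim_inr, file_x, Sum.update_elim_inl, Sum.update_elim_inr, update_file_x,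
      ZOwn.file_Q₁, ZOwn.update_file_Q₁, List.append_nil] at h7
    have h8 := runs_clear (ι := ZReg) (.inr .y)
      (Sum.elim (ZOwn.file [] (norm (subRes q p)) p₂ q₂ r₁ r₂ mm ww) (AReg.file [] p z [] [] [] [] []))
    simp only [Sum.elim_inr, file_y, Sum.update_elim_inr, update_file_y] at h8
    have hbr := Runs.pop_nil (k := (Sum.inr AReg.g : ZReg))
      (bk normalize ;; move (.inr .x) (.inl .P₁) (.inr .t) ;; clear (.inr .y))
      (bk normalize ;; move (.inr .x) (.inl .P₁) (.inr .t) ;; clear (.inr .y))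
      (R := Sum.elim (ZOwn.file [] [] p₂ q₂ r₁ r₂ mm ww) (AReg.file p q z [] [] [] [] [])) rfl
      (e1.seq (e2.seq (e3.seq (e4.seq (h4.seq (h5.seq (h6.seq (h7.seq h8))))))))
    have hlen : (subRes q p).length = q.length := length_subRes q p
    have hnorm := length_norm_le (subRes q p)
    refine (h1.seq (h2.seq (h3.seq hbr))).of_eq ?_ ?_
    · simp only [pnormP, pnormQ, if_neg hle, norm_eq_encodeNat, bitsToNat_subRes q p hlt.le]
    · simp only [List.length_reverse, List.length_singleton]
      omega

end Com

end Literature.Computability.Complexity
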